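import Literature.Probability.LatticeModels.PolymerPressure
import Literature.Analysis.Complex.LocallyUniformLimitSCV
import HarnessLib

/-!
# Analyticity of the polymer pressure in parameters (Vitali / Weierstrass)

Companion of `PolymerPressure.lean`: the "remark following Proposition 2.2" of Ueltschi (1999)
and [KP86, p. 493] — "whenever `Φ` is analytic in some parameter, then clearly both `Z(V)` and
`Φ^T(C)` are analytic, and thus the estimate (4) and Vitali theorem imply the analyticity of the
free energy". Precisely: if activities `ρ_z(A)` of subset polymers of `ℤ^d` depend
complex-differentiably on a parameter `z` in an open set `U` of a finite-dimensional complex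
normed space and satisfy `IsSmallTIActivity (ρ z) δ` uniformly in `z ∈ U`, then

* `differentiableOn_polymerLogZ_param`: every finite-volume `z ↦ log Ξ(Λ; ρ_z)` (the
  Kotecký–Preiss branch `polymerLogZ`) is complex-differentiable on `U` (it is a continuous
  logarithm of the polynomial `z ↦ Ξ(Λ; ρ_z)`, which has no zeros);
* `tendstoUniformlyOn_polymerLogZ_box_div_card`: `log Ξ(Λ_L; ρ_z)/|Λ_L| → p(ρ_z)` uniformly on `U`
  (the rate `K/(2L+1)` of `PolymerPressure` only depends on `d` and `δ`);
* `analyticOnNhd_polymerPressure`: **the pressure `z ↦ p(ρ_z)` is analytic on `U`** (several-variable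
  Weierstrass theorem `Literature.Analysis.Complex.SCV.analyticOnNhd_of_tendstoLocallyUniformlyOn`).

Also recorded, for real parameters: if all activities are real then `log Ξ(Λ)` is real, `Ξ(Λ) > 0`
and `log Ξ(Λ) = Real.log Ξ(Λ)` (`polymerLogZ_eq_log_of_real`). Everything is PROVED.

## References

* [KP86] R. Kotecký, D. Preiss, Comm. Math. Phys. 103 (1986) 491–498, p. 493. [KoteckyPreiss1986]
* D. Ueltschi, J. Stat. Phys. 95 (1999) 693, Prop. 2.2 and the following remark; proof of
  Thm. 2.1 (i) ("by Vitali theorem"). [Ueltschi1999]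
-/

noncomputable section

open Finset Filter Topology Set MeasureTheory intervalIntegral
open scoped BigOperators

namespace Literature.Probability.LatticeModels

/-! ### Continuity and differentiability of `log Z(B; v_z)` in a parameter -/

section Param

variable {P : Type*} [DecidableEq P] {inc : P → P → Prop} [DecidableRel inc]

/-- The partition function along the ray `u • v_x` is jointly continuous in a parameter `x` and
the ray parameter `u`, when the activities are continuous in `x`. [folklore] -/
theorem continuous_polymerPartitionFunction_param {X : Type*} [TopologicalSpace X]
    {v : X → P → ℂ} (B : Finset P) (hv : ∀ γ ∈ B, Continuous fun x => v x γ) :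
    Continuous fun p : X × ℝ =>
      polymerPartitionFunction inc (fun γ => (p.2 : ℂ) * v p.1 γ) B := by
  have hfun : (fun p : X × ℝ => polymerPartitionFunction inc (fun γ => (p.2 : ℂ) * v p.1 γ) B) =
      fun p => ∑ Y ∈ B.powerset with IsCompatible inc Y, ∏ γ ∈ Y, ((p.2 : ℂ) * v p.1 γ) := by
    funext p
    rw [polymerPartitionFunction_eq_sum_filter]
  rw [hfun]
  refine continuous_finsetSum _ fun Y hY => continuous_finsetProd _ fun γ hγ => ?_
  have hγB : γ ∈ B := Finset.mem_powerset.1 (Finset.mem_filter.1 hY).1 hγ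
  exact (Complex.continuous_ofReal.comp continuous_snd).mul ((hv γ hγB).comp continuous_fst)

/-- The ray derivative is jointly continuous in a parameter and the ray parameter. [folklore] -/
theorem continuous_polymerRayDeriv_param {X : Type*} [TopologicalSpace X]
    {v : X → P → ℂ} (B : Finset P) (hv : ∀ γ ∈ B, Continuous fun x => v x γ) :
    Continuous fun p : X × ℝ => polymerRayDeriv inc (v p.1) B p.2 := by
  unfold polymerRayDeriv
  refine continuous_finsetSum _ fun Y hY => ?_
  refine (continuous_const.mul ?_).mul (continuous_finsetProd _ fun γ hγ => ?_)
  · fun_prop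
  · have hγB : γ ∈ B := Finset.mem_powerset.1 (Finset.mem_filter.1 hY).1 hγ
    exact (hv γ hγB).comp continuous_fst

/-- The partition function is continuous in a parameter. [folklore] -/
theorem continuousOn_polymerPartitionFunction_param {X : Type*} [TopologicalSpace X]
    {v : X → P → ℂ} (B : Finset P) {S : Set X} (hv : ∀ γ ∈ B, ContinuousOn (fun x => v x γ) S) :
    ContinuousOn (fun x => polymerPartitionFunction inc (v x) B) S := by
  have hfun : (fun x => polymerPartitionFunction inc (v x) B) =
      fun x => ∑ Y ∈ B.powerset with IsCompatible inc Y, ∏ γ ∈ Y, v x γ := by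
    funext x
    rw [polymerPartitionFunction_eq_sum_filter]
  rw [hfun]
  refine continuousOn_finsetSum _ fun Y hY => continuousOn_finsetProd _ fun γ hγ => ?_
  exact hv γ (Finset.mem_powerset.1 (Finset.mem_filter.1 hY).1 hγ)

/-- **Continuity of the Kotecký–Preiss logarithm in a parameter**: if the activities `v_x(γ)`,
`γ ∈ B`, are continuous in `x` on `S` and the partition functions of `B` along the rays
`u • v_x`, `u ∈ [0,1]`, do not vanish for `x ∈ S`, then `x ↦ log Z(B; v_x)` is continuous on `S`
(clamped parametric integral, as in `continuousOn_polymerLogZ_scaled`). [cite: KoteckyPreiss1986, §2 (log 𝒵(L; Φ) as a continuous branch on a contractible zero-free set)] -/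
theorem continuousOn_polymerLogZ_param {X : Type*} [TopologicalSpace X] {v : X → P → ℂ}
    (B : Finset P) {S : Set X} (hv : ∀ γ ∈ B, ContinuousOn (fun x => v x γ) S)
    (hS : ∀ x ∈ S, ∀ u ∈ Set.Icc (0 : ℝ) 1,
      polymerPartitionFunction inc (fun γ => (u : ℂ) * v x γ) B ≠ 0) :
    ContinuousOn (fun x => polymerLogZ inc (v x) B) S := by
  have hclamp : Continuous fun u : ℝ => max 0 (min 1 u) := by fun_prop
  have hmem : ∀ u : ℝ, max 0 (min 1 u) ∈ Set.Icc (0 : ℝ) 1 := fun u =>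
    ⟨le_max_left _ _, max_le zero_le_one (min_le_left _ _)⟩
  -- restrict to the subtype `S`
  have hv' : ∀ γ ∈ B, Continuous fun x : S => v x.1 γ := fun γ hγ =>
    continuousOn_iff_continuous_restrict.1 (hv γ hγ)
  have hg : Continuous fun q : S × ℝ => (q.1, max 0 (min 1 q.2)) :=
    continuous_fst.prodMk (hclamp.comp continuous_snd)
  have hnum := (continuous_polymerRayDeriv_param (inc := inc) (v := fun x : S => v x.1) B hv').comp hg
  have hden := (continuous_polymerPartitionFunction_param (inc := inc) (v := fun x : S => v x.1) B hv').comp hg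
  have hF := hnum.div hden fun p => hS p.1.1 p.1.2 _ (hmem p.2)
  have key := intervalIntegral.continuous_parametric_intervalIntegral_of_continuous'
    (μ := MeasureTheory.volume)
    (f := fun (x : S) (u : ℝ) =>
      ((fun p : S × ℝ => polymerRayDeriv inc (v p.1.1) B p.2) ∘
          fun q : S × ℝ => (q.1, max 0 (min 1 q.2))) (x, u) /
        ((fun p : S × ℝ =>
            polymerPartitionFunction inc (fun γ => (p.2 : ℂ) * v p.1.1 γ) B) ∘
          fun q : S × ℝ => (q.1, max 0 (min 1 q.2))) (x, u)) hF 0 1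
  rw [continuousOn_iff_continuous_restrict]
  refine key.congr fun x => ?_
  rw [Set.restrict_apply, polymerLogZ_eq_integral_clamp (inc := inc) (v x.1) B]
  rfl

/-- **A continuous logarithm of a differentiable non-vanishing function is differentiable**
(several variables): if `ψ` is continuous at `z₀`, `exp (ψ z) = ζ z` near `z₀`, and `ζ` is
complex-differentiable at `z₀` with `ζ z₀ ≠ 0`, then `ψ` is complex-differentiable at `z₀` (near
`z₀` it agrees with `log (ζ z / ζ z₀) + ψ z₀`). [folklore] -/
theorem differentiableAt_of_exp_eq {E : Type*} [NormedAddCommGroup E] [NormedSpace ℂ E]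
    {ψ ζ : E → ℂ} {z₀ : E} (hψ : ContinuousAt ψ z₀)
    (hexp : ∀ᶠ z in 𝓝 z₀, Complex.exp (ψ z) = ζ z) (hζ : DifferentiableAt ℂ ζ z₀) (hne : ζ z₀ ≠ 0) :
    DifferentiableAt ℂ ψ z₀ := by
  set Λf : E → ℂ := fun z => Complex.log (ζ z / ζ z₀) + ψ z₀ with hΛf
  have hquot : Tendsto (fun z => ζ z / ζ z₀) (𝓝 z₀) (𝓝 1) := by
    have := hζ.continuousAt.div_const (ζ z₀)
    rwa [ContinuousAt, div_self hne] at this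
  have hslit : ∀ᶠ z in 𝓝 z₀, ζ z / ζ z₀ ∈ Complex.slitPlane :=
    hquot.eventually (Complex.isOpen_slitPlane.mem_nhds (by simp))
  have hΛd : DifferentiableAt ℂ Λf z₀ := by
    have h1 : DifferentiableAt ℂ (fun z => ζ z / ζ z₀) z₀ := by
      simp_rw [div_eq_mul_inv]; exact hζ.mul_const _
    have h2 : DifferentiableAt ℂ (fun z => Complex.log (ζ z / ζ z₀)) z₀ :=
      (Complex.differentiableAt_log (by rw [div_self hne]; simp)).comp z₀ h1
    exact h2.add_const _
  have hdiff : ∀ᶠ z in 𝓝 z₀, Complex.exp (ψ z - Λf z) = 1 := by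
    filter_upwards [hexp, hslit] with z hz hs
    have hζz : ζ z ≠ 0 := fun h0 => by
      rw [h0, zero_div] at hs
      exact Complex.slitPlane_ne_zero hs rfl
    rw [Complex.exp_sub, hz, hΛf]
    simp only
    rw [Complex.exp_add, Complex.exp_log (div_ne_zero hζz hne)]
    have hψ₀ : Complex.exp (ψ z₀) = ζ z₀ := hexp.self_of_nhds
    rw [hψ₀]
    field_simp
  have hsmall : ∀ᶠ z in 𝓝 z₀, ‖ψ z - Λf z‖ < 2 * Real.pi := by
    have hc : ContinuousAt (fun z => ψ z - Λf z) z₀ := hψ.sub hΛd.continuousAt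
    have h0 : ψ z₀ - Λf z₀ = 0 := by simp [hΛf, div_self hne]
    have := hc.norm
    rw [ContinuousAt, h0, norm_zero] at this
    exact this.eventually (gt_mem_nhds (by positivity))
  have heq : ∀ᶠ z in 𝓝 z₀, ψ z = Λf z := by
    filter_upwards [hdiff, hsmall] with z h1 h2
    exact sub_eq_zero.1 (eq_zero_of_exp_eq_one_of_norm_lt h1 h2)
  exact hΛd.congr_of_eventuallyEq heq

/-- Finite products of complex-differentiable scalar functions on a set are complex-differentiable
(general normed domain). [folklore] -/
theorem differentiableOn_finset_prod_fun {E : Type*} [NormedAddCommGroup E] [NormedSpace ℂ E]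
    {ι : Type*} (u : Finset ι) {f : ι → E → ℂ} {s : Set E}
    (h : ∀ i ∈ u, DifferentiableOn ℂ (f i) s) : DifferentiableOn ℂ (fun z => ∏ i ∈ u, f i z) s := by
  classical
  induction u using Finset.induction_on with
  | empty => simp
  | insert a u ha ih =>
    simp_rw [Finset.prod_insert ha]
    exact (h a (Finset.mem_insert_self a u)).mul (ih fun i hi => h i (Finset.mem_insert_of_mem hi))

/-- **Differentiability of the Kotecký–Preiss logarithm in a parameter**: if the activities are
complex-differentiable in `z` on an open `U` and the partition functions of `B` along the rays do
not vanish on `U`, then `z ↦ log Z(B; v_z)` is complex-differentiable on `U`. [cite: KoteckyPreiss1986, p. 493 ("both Z(V) and Φ^T(C) are analytic")] -/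
theorem differentiableOn_polymerLogZ_param {E : Type*} [NormedAddCommGroup E] [NormedSpace ℂ E]
    {v : E → P → ℂ} (B : Finset P) {U : Set E} (hU : IsOpen U)
    (hv : ∀ γ ∈ B, DifferentiableOn ℂ (fun z => v z γ) U)
    (hZ : ∀ z ∈ U, ∀ u ∈ Set.Icc (0 : ℝ) 1,
      polymerPartitionFunction inc (fun γ => (u : ℂ) * v z γ) B ≠ 0) :
    DifferentiableOn ℂ (fun z => polymerLogZ inc (v z) B) U := by
  intro z₀ hz₀
  have hnhds : U ∈ 𝓝 z₀ := hU.mem_nhds hz₀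
  have hcont : ContinuousOn (fun z => polymerLogZ inc (v z) B) U :=
    continuousOn_polymerLogZ_param B (fun γ hγ => (hv γ hγ).continuousOn) hZ
  have hζ : DifferentiableOn ℂ (fun z => polymerPartitionFunction inc (v z) B) U := by
    have hfun : (fun z => polymerPartitionFunction inc (v z) B) =
        fun z => ∑ Y ∈ B.powerset with IsCompatible inc Y, ∏ γ ∈ Y, v z γ := by
      funext z; rw [polymerPartitionFunction_eq_sum_filter]
    rw [hfun]
    refine DifferentiableOn.fun_sum fun Y hY => differentiableOn_finset_prod_fun Y fun γ hγ => ?_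
    exact hv γ (Finset.mem_powerset.1 (Finset.mem_filter.1 hY).1 hγ)
  have hexp : ∀ᶠ z in 𝓝 z₀, Complex.exp (polymerLogZ inc (v z) B) = polymerPartitionFunction inc (v z) B := by
    filter_upwards [hnhds] with z hz
    exact exp_polymerLogZ fun t ht => hZ z hz t ht
  have hne : polymerPartitionFunction inc (v z₀) B ≠ 0 := by
    have := hZ z₀ hz₀ 1 ⟨zero_le_one, le_rfl⟩
    simpa using this
  exact (differentiableAt_of_exp_eq (hcont.continuousAt hnhds) hexp
    ((hζ z₀ hz₀).differentiableAt hnhds) hne).differentiableWithinAt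

end Param

/-! ### Analyticity of the pressure -/

section Pressure

variable {d : ℕ} {E : Type*} [NormedAddCommGroup E] [NormedSpace ℂ E]

/-- In a family of small translation-invariant activities, every finite-volume logarithm
`z ↦ log Ξ(Λ; ρ_z)` is complex-differentiable in the parameter. [cite: KoteckyPreiss1986, p. 493] -/
theorem differentiableOn_polymerLogZ_powerset {ρ : E → Finset (Site d) → ℂ} {δ : ℝ} {U : Set E}
    (hU : IsOpen U) (hρ : ∀ A, DifferentiableOn ℂ (fun z => ρ z A) U)
    (h : ∀ z ∈ U, IsSmallTIActivity (ρ z) δ) (Λ : Finset (Site d)) :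
    DifferentiableOn ℂ (fun z => polymerLogZ polyInc (ρ z) Λ.powerset) U := by
  refine differentiableOn_polymerLogZ_param Λ.powerset hU (fun A _ => hρ A) fun z hz u hu => ?_
  have hKP : IsKPVolume polyInc (ρ z) (fun A : Finset (Site d) => (A.card : ℝ)) Λ.powerset :=
    isKPVolume_of_tsum_le (inc := polyInc) (w := ρ z) (a := fun A : Finset (Site d) => (A.card : ℝ))
      (d := fun A : Finset (Site d) => δ * (A.card : ℝ))
      (fun A => mul_nonneg (h z hz).delta_pos.le (Nat.cast_nonneg _))
      (fun γ => (h z hz).kp_hypothesis γ) Λ.powerset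
  have hKPu : IsKPVolume polyInc (fun A => (u : ℂ) * ρ z A) (fun A : Finset (Site d) => (A.card : ℝ))
      Λ.powerset := fun γ hγ => by
    refine le_trans (Finset.sum_le_sum fun γ' _ => ?_) (hKP γ hγ)
    unfold kpTerm
    refine mul_le_mul_of_nonneg_right ?_ (Real.exp_nonneg _)
    rw [norm_mul, Complex.norm_real, Real.norm_eq_abs, abs_of_nonneg hu.1]
    exact mul_le_of_le_one_left (norm_nonneg _) hu.2
  exact polymerPartitionFunction_ne_zero_of_kp hKPu Finset.Subset.rfl

/-- **Uniform convergence of the finite-volume pressures**: the rate `K/(2L+1)` of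
`norm_polymerLogZ_box_div_card_sub_polymerPressure_le` only depends on `d` and `δ`. [cite: Ueltschi1999, Proposition 2.2 and the remark following it] -/
theorem tendstoUniformlyOn_polymerLogZ_box_div_card {X : Type*} {ρ : X → Finset (Site d) → ℂ}
    {δ : ℝ} {U : Set X} (hd : 1 ≤ d) (h : ∀ z ∈ U, IsSmallTIActivity (ρ z) δ) :
    TendstoUniformlyOn
      (fun (L : ℕ) (z : X) => polymerLogZ polyInc (ρ z) (box d L).powerset / ((box d L).card : ℂ))
      (fun z => polymerPressure (ρ z)) atTop U := by
  set K : ℝ := (2 * d + 1) * (Real.exp (-δ) ^ 2 / (1 - Real.exp (-δ))) with hK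
  have hlim : Tendsto (fun L : ℕ => K / (2 * L + 1 : ℝ)) atTop (𝓝 0) := by
    have h2L : Tendsto (fun L : ℕ => (2 * L + 1 : ℝ)) atTop atTop :=
      tendsto_atTop_add_const_right _ 1 (tendsto_natCast_atTop_atTop.const_mul_atTop two_pos)
    exact tendsto_const_nhds.div_atTop h2L
  rw [Metric.tendstoUniformlyOn_iff]
  intro ε hε
  filter_upwards [(tendsto_order.1 hlim).2 ε hε] with L hL z hz
  rw [dist_comm, dist_eq_norm]
  exact ((h z hz).norm_polymerLogZ_box_div_card_sub_polymerPressure_le hd L).trans_lt hL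

/-- **Analyticity of the pressure in the parameters** ([KP86] p. 493; Ueltschi 1999, "by
Vitali theorem"): for a complex-differentiable family `z ↦ ρ_z` of uniformly small
translation-invariant activities on an open subset `U` of a finite-dimensional complex normed
space (`d ≥ 1`), the pressure `z ↦ p(ρ_z)` is analytic on `U` — it is the uniform limit of the
holomorphic finite-volume pressures. [cite: Ueltschi1999, Proposition 2.2 and the remark following it; proof of Theorem 2.1 (i)] -/
theorem analyticOnNhd_polymerPressure [FiniteDimensional ℂ E] {ρ : E → Finset (Site d) → ℂ}
    {δ : ℝ} {U : Set E} (hU : IsOpen U) (hd : 1 ≤ d)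
    (hρ : ∀ A, DifferentiableOn ℂ (fun z => ρ z A) U) (h : ∀ z ∈ U, IsSmallTIActivity (ρ z) δ) :
    AnalyticOnNhd ℂ (fun z => polymerPressure (ρ z)) U := by
  refine Literature.Analysis.Complex.SCV.analyticOnNhd_of_tendstoLocallyUniformlyOn hU
    (fun L => ?_) (tendstoUniformlyOn_polymerLogZ_box_div_card hd h).tendstoLocallyUniformlyOn
  have hdiv : (fun z => polymerLogZ polyInc (ρ z) (box d L).powerset / ((box d L).card : ℂ)) =
      fun z => polymerLogZ polyInc (ρ z) (box d L).powerset * ((box d L).card : ℂ)⁻¹ := by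
    funext z; rw [div_eq_mul_inv]
  rw [hdiv]
  exact (differentiableOn_polymerLogZ_powerset hU hρ h (box d L)).mul_const _

end Pressure

/-! ### Real activities: the Kotecký–Preiss logarithm is the real logarithm -/

section RealActivities

variable {P : Type*} [DecidableEq P] {inc : P → P → Prop} [DecidableRel inc]

/-- For real activities the partition function is real. [folklore] -/
theorem polymerPartitionFunction_im_eq_zero {w : P → ℂ} (hw : ∀ γ, (w γ).im = 0) (B : Finset P) :
    (polymerPartitionFunction inc w B).im = 0 := by
  have hreal : ∀ γ, w γ = ((w γ).re : ℂ) := fun γ => by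
    apply Complex.ext <;> simp [hw γ]
  rw [polymerPartitionFunction_eq_sum_filter, Complex.im_sum]
  refine Finset.sum_eq_zero fun Y _ => ?_
  rw [Finset.prod_congr rfl fun γ _ => hreal γ, ← Complex.ofReal_prod, Complex.ofReal_im]

/-- For real activities the ray derivative is real. [folklore] -/
theorem polymerRayDeriv_im_eq_zero {w : P → ℂ} (hw : ∀ γ, (w γ).im = 0) (B : Finset P) (t : ℝ) :
    (polymerRayDeriv inc w B t).im = 0 := by
  have hreal : ∀ γ, w γ = ((w γ).re : ℂ) := fun γ => by
    apply Complex.ext <;> simp [hw γ]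
  unfold polymerRayDeriv
  rw [Complex.im_sum]
  refine Finset.sum_eq_zero fun Y _ => ?_
  rw [Finset.prod_congr rfl fun γ _ => hreal γ, ← Complex.ofReal_prod, ← Complex.ofReal_pow,
    ← Complex.ofReal_natCast, ← Complex.ofReal_mul, ← Complex.ofReal_mul, Complex.ofReal_im]

/-- **For real activities in a zero-free region the Kotecký–Preiss logarithm is real and is the
real logarithm of the (positive) partition function.** [folklore] -/
theorem polymerLogZ_eq_log_of_real {w : P → ℂ} (hw : ∀ γ, (w γ).im = 0) {B : Finset P}
    (hZ : ∀ t ∈ Set.Icc (0 : ℝ) 1, polymerPartitionFunction inc (fun γ => (t : ℂ) * w γ) B ≠ 0) :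
    0 < (polymerPartitionFunction inc w B).re ∧
      polymerLogZ inc w B = (Real.log (polymerPartitionFunction inc w B).re : ℂ) := by
  -- the integrand is real
  have him : ∀ t : ℝ, (polymerRayDeriv inc w B t /
      polymerPartitionFunction inc (fun γ => (t : ℂ) * w γ) B).im = 0 := by
    intro t
    have h1 := polymerRayDeriv_im_eq_zero (inc := inc) hw B t
    have h2 := polymerPartitionFunction_im_eq_zero (inc := inc) (w := fun γ => (t : ℂ) * w γ)
      (fun γ => by simp [hw γ]) B
    rw [Complex.div_im, h1, h2]
    ring
  set q : ℝ → ℂ := fun t => polymerRayDeriv inc w B t /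
    polymerPartitionFunction inc (fun γ => (t : ℂ) * w γ) B with hqdef
  have hq : ∀ t, q t = (((q t).re : ℝ) : ℂ) := fun t =>
    Complex.ext (by simp) (by rw [Complex.ofReal_im]; exact him t)
  set r : ℝ := ∫ t in (0 : ℝ)..1, (q t).re with hr
  have hL : polymerLogZ inc w B = (r : ℂ) := by
    unfold polymerLogZ
    rw [hr, ← intervalIntegral.integral_ofReal]
    exact intervalIntegral.integral_congr fun t _ => hq t
  have hexpZ := exp_polymerLogZ hZ
  rw [hL, ← Complex.ofReal_exp] at hexpZ
  have hre : (polymerPartitionFunction inc w B).re = Real.exp r := by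
    rw [← hexpZ, Complex.ofReal_re]
  refine ⟨by rw [hre]; exact Real.exp_pos r, ?_⟩
  rw [hL, hre, Real.log_exp]

end RealActivities

end Literature.Probability.LatticeModels
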